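import Summits.AnomalousDissipation.AnomalousDissipation.Theorems.MarginalStabilityChainStrainedLayerLawSumRuleLine
import Summits.AnomalousDissipation.AnomalousDissipation.Theorems.MarginalStabilityChainStrainedLayerLawParallelRelaxStubClassTools
import Summits.AnomalousDissipation.AnomalousDissipation.Theorems.MarginalStabilityChainStrainedLayerLawParallelRelaxStubCaloric
import Literature.Analysis.FluidPDE.StretchedLayerNSBurgers
import Literature.Analysis.UnboundedOperators.HeatKernelHeatEquation
import HarnessLib
import Summits.AnomalousDissipation.AnomalousDissipation.Theorems.MarginalStabilityChainStrainedLayerLawParallelRelaxStubTools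

/-!
# Crux `MarginalStabilityChain.StrainedLayerLaw` (stmt-AnomalousDissipation-3007), line `FirstLemmasR2K4`:
# the PARALLEL MEMBER of the crux's class from an x-independent perturbation (strained shear diffusion)

Support file (`--supports stmt-AnomalousDissipation-3007`; registered sub-goal `parallelRelax_member`). Line lead c5
(`prover-line-stmt-AnomalousDissipation-3007-c5-0`, 2026-08-16). First half of the PARALLEL-RELAXATION package, whose
conclusion (`…ParallelRelax.lean`: `parallelMember_meanLayerDissipation`, `strainedLayerLaw_xIndependent_false`) is the
unconditional, importable form of the disprover's §4 (`Cruxes/StrainedLayerLaw/Disproof.lean`, `ParallelRelaxes`): the crux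
`StrainedLayerLaw` with its `∃ θ` restricted to x-INDEPENDENT admissible perturbations is FALSE — the witness θ of the crux
(and of the line's open stub `stub_roundnessFloor`) must depend on `x`.

Contents (γ = ΔU = 1, the crux's normalisation):
* the clock `s(t) = ν(e^{2t} − 1)/2` and the **strained shear diffusion** `P(t,y) = ∫ G₁(z) g(eᵗy − √s(t) z) dz` of a datum `g`
  (file-local notations `sclock[ν, t]`, `sdiff[ν, g, t, y]`; NO definitions are introduced — every statement is about the explicit
  formulas) — Majda–Bertozzi 2002 §1.4 eq. (1.34) written through the tree's caloric extension: for `t > 0` it is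
  `(e^{s(t)Δ}g)(eᵗy)` (`sdiff_eq_heatExtension`), at `t = 0` it is `g`, jointly continuous on `ℝ²`, jointly `C²` on
  `{t > 0} × ℝ`, and it solves `P_t = yP_y + νP_yy` (`sdiff_pde`; the chain rule is the landed `stub_strainedCaloricCalculus`,
  p129680);
* `inCruxClass_parallel` / `parallelRelax_member`: for `ν > 0`, every period `L` and every `g ∈ C²_c(ℝ)` the parallel flow
  `u = U_B^ν(y) + P(t,y)`, `v = p = 0`, is a member of `InCruxClass ν L (fun _ y => g y) 0` (the crux's inlined class,
  `…SumRuleLine`): regularity, the stretched system, periodicity, far field `±½` (landed `stub_parallelClassTools`, p129557),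
  and the crux's inlined datum `(2πν)^{-1/2}∫₀^y e^{−s²/2ν}ds + g` (`burgersLayerProfile_one_eq`).

No facts are asserted. References: Majda–Bertozzi 2002 §1.4 (1.34) (strained shear layers); Evans 2010 §2.3.1 (heat kernel);
tree `Literature/Analysis/UnboundedOperators/HeatKernelHeatEquation.lean`, `Literature/Analysis/FluidPDE/StretchedLayerNSBurgers.lean`.
-/

noncomputable section

open scoped Topology ENNReal
open Filter Set Function MeasureTheory

-- `Summit.<Summit>.<Problem>` is the tree's mandated summit-side namespace (CONVENTIONS §2); for this
-- single-conjunct summit the two coincide, so the duplicate is deliberate.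
set_option linter.dupNamespace false

namespace Summit.AnomalousDissipation.AnomalousDissipation.Theorems.StrainedLayerLaw.ParallelRelax

open Literature.Analysis.FluidPDE Literature.Analysis.FluidPDE.StretchedLayer
open Literature.Analysis.UnboundedOperators
open Summit.AnomalousDissipation.AnomalousDissipation.Theses.MarginalStabilityChain
open Summit.AnomalousDissipation.AnomalousDissipation.Theorems.StrainedLayerLaw.StrainWorkSumRule

/-! ## The parallel member (lead): the strained shear diffusion `sdiff` and the member `U_B + sdiff` -/

/-! File-local NOTATION (no definitions are introduced; every statement below is about the explicit formulas):
* `sclock[ν, t]` — the clock of the strained heat flow (γ = 1), `s(t) = ν(e^{2t} − 1)/2`, the heat time accumulated by the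
  similarity variable `η = eᵗy` (`s′ = ν e^{2t}`, `s(0) = 0`);
* `sdiff[ν, g, t, y]` — the **strained shear diffusion** of the datum `g`: `P(t,y) = ∫ G₁(z) g(eᵗy − √s(t)·z) dz` with the unit
  heat kernel `G₁`; for `t > 0` this is the caloric extension `(e^{s(t)Δ}g)(eᵗy)` (`sdiff_eq_heatExtension`), for `t ≤ 0` it is
  `g(eᵗy)` (so `P(0,·) = g`), `(t,y) ↦ P` is jointly continuous on `ℝ²`, and it solves the strained heat equation
  `P_t = yP_y + νP_yy` (Majda–Bertozzi 2002 §1.4 eq. (1.34): the x-independent members of the stretched class). -/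
local notation3 (prettyPrint := false) "sclock[" ν ", " t "]" => ν * (Real.exp (2 * t) - 1) / 2
local notation3 (prettyPrint := false) "sdiff[" ν ", " g ", " t ", " y "]" =>
  ∫ z, heatKernel 1 z * g (Real.exp t * y - Real.sqrt (ν * (Real.exp (2 * t) - 1) / 2) * z)

/-- The clock is positive for `t > 0` (`ν > 0`). [folklore] -/
theorem sclock_pos {ν t : ℝ} (hν : 0 < ν) (ht : 0 < t) : 0 < sclock[ν, t] := by
  have : 1 < Real.exp (2 * t) := Real.one_lt_exp_iff.2 (by linarith)
  have h2 : 0 < Real.exp (2 * t) - 1 := by linarith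
  positivity

/-- The clock is nonpositive for `t ≤ 0` (`ν ≥ 0`). [folklore] -/
theorem sclock_nonpos {ν t : ℝ} (hν : 0 ≤ ν) (ht : t ≤ 0) : sclock[ν, t] ≤ 0 := by
  have : Real.exp (2 * t) ≤ 1 := Real.exp_le_one_iff.2 (by linarith)
  have h2 : ν * (Real.exp (2 * t) - 1) ≤ 0 := mul_nonpos_of_nonneg_of_nonpos hν (by linarith)
  linarith

/-- For `t > 0` the strained shear diffusion is the caloric extension at time `s(t)` read at `eᵗy`. [folklore] -/
theorem sdiff_eq_heatExtension {ν : ℝ} (hν : 0 < ν) (g : ℝ → ℝ) {t : ℝ} (ht : 0 < t) (y : ℝ) :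
    sdiff[ν, g, t, y] = heatExtension g (ν * (Real.exp (2 * t) - 1) / 2) (Real.exp t * y) := by
  rw [heatExtension_eq_integral_heatKernel_one (sclock_pos hν ht)]
  simp only [smul_eq_mul]

/-- For `t ≤ 0` (in particular at `t = 0`) the strained shear diffusion is the datum read at `eᵗy`. [folklore] -/
theorem sdiff_of_nonpos {ν : ℝ} (hν : 0 ≤ ν) (g : ℝ → ℝ) {t : ℝ} (ht : t ≤ 0) (y : ℝ) :
    sdiff[ν, g, t, y] = g (Real.exp t * y) := by
  have h := integral_heatKernel_one_smul_of_nonpos (E := ℝ) (sclock_nonpos hν ht) g (Real.exp t * y)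
  simpa only [smul_eq_mul] using h

/-- At `t = 0` the strained shear diffusion is the datum. [folklore] -/
theorem sdiff_zero {ν : ℝ} (hν : 0 ≤ ν) (g : ℝ → ℝ) (y : ℝ) : sdiff[ν, g, 0, y] = g y := by
  rw [sdiff_of_nonpos hν g le_rfl]; simp

/-- Joint continuity of `(t, y) ↦ P(t, y)` on all of `ℝ²` for bounded continuous data. [folklore] -/
theorem continuous_sdiff (ν : ℝ) {g : ℝ → ℝ} (hg : Continuous g) {C : ℝ} (hC : ∀ z, ‖g z‖ ≤ C) :
    Continuous fun q : ℝ × ℝ => sdiff[ν, g, q.1, q.2] := by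
  have h := continuous_integral_heatKernel_one_smul (E := ℝ) hg hC
  have hΦ : Continuous fun q : ℝ × ℝ => (sclock[ν, q.1], Real.exp q.1 * q.2) := by
    fun_prop
  have := h.comp hΦ
  simpa only [Function.comp_def, smul_eq_mul] using this

/-! ### Regularity, the strained heat equation, far field -/

section Member

variable {ν : ℝ} {g : ℝ → ℝ}

/-- Joint `C²` regularity of the strained shear diffusion on `{t > 0} × ℝ` (from the registered
`stub_strainedCaloricCalculus` at `γ = 1`, transported along `sdiff_eq_heatExtension`). [folklore] -/
theorem contDiffOn_sdiff (hν : 0 < ν) (hg : ContDiff ℝ 2 g) (hc : HasCompactSupport g) :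
    ContDiffOn ℝ 2 (fun q : ℝ × ℝ => sdiff[ν, g, q.1, q.2]) (Ioi 0 ×ˢ univ) := by
  have hB := (stub_strainedCaloricCalculus 1 ν g one_pos hν hg hc).1
  simp only [one_mul, mul_one] at hB
  refine hB.congr fun q hq => ?_
  exact sdiff_eq_heatExtension hν g (mem_prod.1 hq).1 q.2

/-- At a fixed `t > 0` the slice `y ↦ P(t, y)` is the smooth `e^{s(t)Δ}g` precomposed with `y ↦ eᵗy`. [folklore] -/
theorem sdiff_slice_eq (hν : 0 < ν) {t : ℝ} (ht : 0 < t) :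
    (fun y => sdiff[ν, g, t, y]) = fun y => heatExtension g (ν * (Real.exp (2 * t) - 1) / 2) (Real.exp t * y) :=
  funext fun y => sdiff_eq_heatExtension hν g ht y

/-- The slice `y ↦ P(t, y)` is `C²` for `t > 0`. [folklore] -/
theorem contDiff_sdiff_slice (hν : 0 < ν) (hg : ContDiff ℝ 2 g) (hc : HasCompactSupport g) {t : ℝ}
    (ht : 0 < t) : ContDiff ℝ 2 (fun y => sdiff[ν, g, t, y]) := by
  rw [sdiff_slice_eq hν ht]
  exact (contDiff_heatExtension_of_hasCompactSupport hg hc _).comp (contDiff_const.mul contDiff_id)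

/-- `∂_y P(t, y) = eᵗ (e^{s(t)Δ}g)′(eᵗy)` for `t > 0`. [folklore] -/
theorem deriv_sdiff_slice (hν : 0 < ν) {t : ℝ} (ht : 0 < t) (y : ℝ) :
    deriv (fun s => sdiff[ν, g, t, s]) y =
      Real.exp t * deriv (heatExtension g (ν * (Real.exp (2 * t) - 1) / 2)) (Real.exp t * y) := by
  rw [sdiff_slice_eq hν ht]
  rw [deriv_comp_mul_left (Real.exp t) (heatExtension g (ν * (Real.exp (2 * t) - 1) / 2)) y, smul_eq_mul]

/-- **The strained heat equation** `P_t = y P_y + ν P_yy` for `t > 0` (from `stub_strainedCaloricCalculus` at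
`γ = 1`, transported along `sdiff_eq_heatExtension`, which holds on the open time set `(0, ∞)`). [folklore] -/
theorem sdiff_pde (hν : 0 < ν) (hg : ContDiff ℝ 2 g) (hc : HasCompactSupport g) {t : ℝ} (ht : 0 < t)
    (y : ℝ) :
    deriv (fun τ => sdiff[ν, g, τ, y]) t =
      y * deriv (fun s => sdiff[ν, g, t, s]) y + ν * deriv (deriv (fun s => sdiff[ν, g, t, s])) y := by
  have hB := (stub_strainedCaloricCalculus 1 ν g one_pos hν hg hc).2 t y ht
  simp only [one_mul, mul_one] at hB
  have hev : (fun τ => sdiff[ν, g, τ, y]) =ᶠ[𝓝 t]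
      fun τ => heatExtension g (ν * (Real.exp (2 * τ) - 1) / 2) (Real.exp τ * y) := by
    filter_upwards [isOpen_Ioi.mem_nhds ht] with τ hτ
    exact sdiff_eq_heatExtension hν g hτ y
  rw [hev.deriv_eq, hB, sdiff_slice_eq hν ht]

/-- Far field of the slices for `t > 0`: `P(t, y) → 0` as `y → ±∞` (compactly supported data). [folklore] -/
theorem tendsto_sdiff_slice (hν : 0 < ν) (hg : Continuous g) (hc : HasCompactSupport g) {t : ℝ}
    (ht : 0 < t) :
    Tendsto (fun y => sdiff[ν, g, t, y]) atTop (𝓝 0) ∧ Tendsto (fun y => sdiff[ν, g, t, y]) atBot (𝓝 0) := by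
  obtain ⟨h1, h2⟩ := stub_parallelClassTools.2.2 g _ hg hc (sclock_pos hν ht)
  rw [sdiff_slice_eq hν ht]
  exact ⟨h1.comp (tendsto_id.const_mul_atTop (Real.exp_pos t)),
    h2.comp (tendsto_id.const_mul_atBot (Real.exp_pos t))⟩

/-- A compactly supported function tends to `0` at `±∞` (tool). [folklore] -/
theorem tendsto_zero_of_hasCompactSupport (hc : HasCompactSupport g) :
    Tendsto g atTop (𝓝 0) ∧ Tendsto g atBot (𝓝 0) :=
  stub_parallelRelaxTools.1 g hc

/-- **The parallel member of the crux's class.** For `ν > 0`, every period `L`, and `g ∈ C²_c(ℝ)`, the parallel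
flow `u(t, x, y) = U_B^ν(y) + P(t, y)`, `v = p = 0`, is a member of `InCruxClass ν L (g ∘ y) 0`: `C²` for `t > 0`,
continuous up to `t = 0`, the stretched system (`U_B`: `νU_B'' = −yU_B'`; `P`: `P_t = yP_y + νP_yy`; all `x`-derivatives
and the `v`-equation vanish), `L`-periodic, far field `±½`, datum `U_B^ν + g` in the crux's inlined normalisation
(`burgersLayerProfile_one_eq`). [folklore] -/
theorem inCruxClass_parallel (hν : 0 < ν) (L : ℝ) (hg : ContDiff ℝ 2 g) (hc : HasCompactSupport g) :
    InCruxClass ν L (fun _ y => g y) (fun _ _ => 0)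
      (fun t _ y => burgersLayerProfile 1 ν 1 y + sdiff[ν, g, t, y]) (fun _ _ _ => 0) (fun _ _ _ => 0) := by
  obtain ⟨C, hC⟩ := hg.continuous.bounded_above_of_compact_support hc
  have hUB : ContDiff ℝ 2 (burgersLayerProfile 1 ν 1) := contDiff_two_burgersLayerProfile 1 ν 1
  refine ⟨?c2, contDiffOn_const, contDiffOn_const, ?c0, continuousOn_const, ?pde, fun _ _ _ _ => ⟨rfl, rfl, rfl⟩,
    ?far, ?datum⟩
  case c2 =>
    have hproj : ContDiff ℝ 2 (fun q : ℝ × ℝ × ℝ => (q.1, q.2.2)) := contDiff_fst.prodMk (contDiff_snd.comp contDiff_snd)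
    have hmaps : MapsTo (fun q : ℝ × ℝ × ℝ => (q.1, q.2.2)) (Ioi (0:ℝ) ×ˢ (univ : Set (ℝ × ℝ)))
        (Ioi 0 ×ˢ univ) := fun q hq => ⟨(mem_prod.1 hq).1, mem_univ _⟩
    have hP : ContDiffOn ℝ 2 (fun q : ℝ × ℝ × ℝ => sdiff[ν, g, q.1, q.2.2]) (Ioi 0 ×ˢ univ) :=
      (contDiffOn_sdiff hν hg hc).comp hproj.contDiffOn hmaps
    exact ((hUB.comp (contDiff_snd.comp contDiff_snd)).contDiffOn).add hP
  case c0 =>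
    have hP : Continuous fun q : ℝ × ℝ × ℝ => sdiff[ν, g, q.1, q.2.2] :=
      (continuous_sdiff ν hg.continuous hC).comp (continuous_fst.prodMk (continuous_snd.comp continuous_snd))
    exact ((hUB.continuous.comp (continuous_snd.comp continuous_snd)).add hP).continuousOn
  case pde =>
    intro t x y ht
    have hPs : ContDiff ℝ 2 (fun s => sdiff[ν, g, t, s]) := contDiff_sdiff_slice hν hg hc ht
    have hPd : Differentiable ℝ (fun s => sdiff[ν, g, t, s]) := hPs.differentiable (by norm_num)
    have hPdd : Differentiable ℝ (deriv (fun s => sdiff[ν, g, t, s])) := hPs.differentiable_deriv_two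
    have hUBd : ∀ s, HasDerivAt (burgersLayerProfile 1 ν 1) (burgersLayerProfileD 1 ν 1 s) s :=
      hasDerivAt_burgersLayerProfile' 1 ν 1
    have hUBdd : ∀ s, HasDerivAt (burgersLayerProfileD 1 ν 1) (burgersLayerProfileDD 1 ν 1 s) s :=
      hasDerivAt_burgersLayerProfileD 1 ν 1
    -- first y-derivative of the sum, as a function
    have hD1 : deriv (fun s => burgersLayerProfile 1 ν 1 s + sdiff[ν, g, t, s]) =
        fun s => burgersLayerProfileD 1 ν 1 s + deriv (fun s => sdiff[ν, g, t, s]) s := by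
      funext s
      exact ((hUBd s).add (hPd s).hasDerivAt).deriv
    have hD2 : deriv (fun s => burgersLayerProfileD 1 ν 1 s + deriv (fun s => sdiff[ν, g, t, s]) s) y =
        burgersLayerProfileDD 1 ν 1 y + deriv (deriv (fun s => sdiff[ν, g, t, s])) y :=
      ((hUBdd y).add (hPdd y).hasDerivAt).deriv
    have hDt : deriv (fun s => burgersLayerProfile 1 ν 1 y + sdiff[ν, g, s, y]) t = deriv (fun s => sdiff[ν, g, s, y]) t :=
      deriv_const_add _
    have hode := burgersLayerProfile_ode 1 ν 1 y
    have hpde := sdiff_pde hν hg hc ht y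
    refine ⟨?_, by simp, by simp⟩
    simp only [deriv_const, mul_zero, add_zero, neg_zero, zero_add, zero_sub]
    rw [hDt, hD1, hD2]
    linarith [hode, hpde]
  case far =>
    intro t x ht
    refine ⟨?_, ?_, tendsto_const_nhds, tendsto_const_nhds⟩
    · have h1 := tendsto_burgersLayerProfile_atTop one_pos hν (1:ℝ)
      rcases ht.eq_or_lt with rfl | ht'
      · have h2 := (tendsto_zero_of_hasCompactSupport hc).1
        have := h1.add h2
        simp only [add_zero] at this
        refine this.congr' (Eventually.of_forall fun y => ?_)
        beta_reduce
        rw [sdiff_zero hν.le g y]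
      · have h2 := (tendsto_sdiff_slice hν hg.continuous hc ht').1
        have := h1.add h2
        simpa only [add_zero] using this
    · have h1 := tendsto_burgersLayerProfile_atBot one_pos hν (1:ℝ)
      rcases ht.eq_or_lt with rfl | ht'
      · have h2 := (tendsto_zero_of_hasCompactSupport hc).2
        have := h1.add h2
        simp only [add_zero] at this
        refine this.congr' (Eventually.of_forall fun y => ?_)
        beta_reduce
        rw [sdiff_zero hν.le g y]
      · have h2 := (tendsto_sdiff_slice hν hg.continuous hc ht').2
        have := h1.add h2
        simpa only [add_zero] using this
  case datum =>
    intro x y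
    refine ⟨?_, rfl⟩
    beta_reduce
    rw [sdiff_zero hν.le g y, burgersLayerProfile_one_eq hν 1 y, one_mul]

end Member

/-- **Registered sub-goal `parallelRelax_member`** (= `inCruxClass_parallel`, ∀-form, the member written out in full): the
parallel member of the crux's class from an x-independent perturbation. [folklore] -/
theorem parallelRelax_member :
    ∀ (ν L : ℝ) (g : ℝ → ℝ), 0 < ν → ContDiff ℝ 2 g → HasCompactSupport g →
      InCruxClass ν L (fun _ y => g y) (fun _ _ => 0)
        (fun t _ y => burgersLayerProfile 1 ν 1 y +
          ∫ z, heatKernel 1 z * g (Real.exp t * y - Real.sqrt (ν * (Real.exp (2 * t) - 1) / 2) * z))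
        (fun _ _ _ => 0) (fun _ _ _ => 0) :=
  fun _ L _ hν hg hc => inCruxClass_parallel hν L hg hc

end Summit.AnomalousDissipation.AnomalousDissipation.Theorems.StrainedLayerLaw.ParallelRelax

end
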